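import Summits.QuantumFields.YangMills.Theorems.BalabanUVNodesN19RateEdgeRecordRunLettersTuned
import Summits.QuantumFields.YangMills.Theorems.BalabanUVNodesN19InEdgesAtRecord

/-!
# BalabanUVNodes ∕ N19 — (v′-17)'s β-WINDOW LETTER READ ALONG THE RUNS: node U2's output (N17 · (D4) · N18 · N22 BY NAME) needs the lower β-bound
# ONLY ALONG THE TWO RUNS' OWN HISTORIES, not on the whole box — and along the runs of record it is K1⁷'s interval-form window (lower half)

Cell `pub-ymgap`, HUMAN RULING D-0062 (Track A) + D-0149 (work-bound push, director-ym №197), WIDTH SEAT `pub-ymgap-dag-n19-w3` (N19 NE7, seat 3 of 3),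
generation g2; bus INTENT-5.  Cluster item K3⁷ «SpineGivenEndpointR13SepCoPH» (stmt-QuantumFields-20544); filed `--kind proof --supports` that item `--as helper` (it
proves no registered stub).  COUNT-NEUTRAL.  THEOREMS ONLY; 0 `def`; 0 `sorry`; NO Theses import.  Imports this seat's `…N19RateEdgeRecordRunLettersTuned` (g0 p586951:
`betaAlong_runFlow_le_of_betaBoundsInInterval`, `rgEqH_runFlow_datumOfRecord₁₃CoPH_of_tuned`) and dag-n19-a's `…N19InEdgesAtRecord` (p429658: `injectedRate_of_n17At`,
`histCompanions_of_readOutAt`, `injectedRate_of_n17At_readOutAt`) — CITED BY NAME, none edited.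

THE POINT (numbers, not adjectives).  In every N19′ link reading (v9 p475545 → E p582895 → J p589854 → this seat's `…D4AtRuns` p593217) the (v′-17) block carries
`0 < bβ ∧ EventualLowerH bβ R.u3.γ k₀β D.βfun` — a lower bound `bβ ≤ β_m(v)` for EVERY history `v` in the γ-box ([Balaban1987RG1] (0.31)∕(1.22) lower half; UNPRINTED,
T09.F; this seat's g0 §3 could only read it from the K1-side BOX binder `BetaLowerH`).  The knit consumes it through dag-n19-a's `injectedRate_of_n17At_readOutAt` →
`T4CouplingMatching.injectedRate_of_runs_eventual` → `sum_weights_le_of_eventualLower` → `inv_sq_lower_of_eventualLower`, and THERE it is evaluated ONLY at `prefixOf (g K) m`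
and `prefixOf (g (K+1)) m` — along the two runs (l.693–695 of `T4CouplingMatching`).  So the weaker ALONG-THE-RUNS letter `∀ K m, k₀ ≤ m → m < K → b ≤ D.βfun m (prefixOf (g K) m)`
suffices (§1–§2, the tree's proofs re-run with the hypothesis read along the runs), and for the runs of record of a TUNED bare sequence that letter IS the lower half of
K1⁷'s interval-form window `DagBinding.BetaBoundsInInterval D.C.toB12 γ₀ b b′` (`γ ≤ γ₀`; §3 `betaAlong_runFlow_ge_of_betaBoundsInInterval`, the twin of g0's upper-half lemma, via
`D.curries` + `DagBinding.update_prefixOf_last`) — with `k₀ := 0`.  Downstream (INTENT-6∕7): E's rate edge with the β-window letter read along the runs, and this seat's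
AtRuns face with `0 < bβ ∧ EventualLowerH …` DISCHARGED from K1⁷'s window (`bβ := b`, `k₀β := 0`).

WHAT THIS FILE PROVES.
* §1 (generic `HBeta`) `inv_sq_lower_of_alongLower` · `sum_weights_le_of_alongLower` · `injectedRate_of_runs_along` — `T4CouplingMatching`'s `inv_sq_lower_of_eventualLower` ∕
  `sum_weights_le_of_eventualLower` ∕ `injectedRate_of_runs_eventual` with `EventualLowerH b γ k₀ β` replaced by the along-the-run(s) bound; proofs = the tree's, the one
  changed step being where `hlo` is read.  [folklore]
* §2 (node U3's carriers) `injectedRate_of_n17At_along` · `injectedRate_of_n17At_readOutAt_along` — dag-n19-a's two N17 composites with the same replacement;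
  `injectedRate_of_n17At_readOutAt_along_radius` — the same with the runs' box and the smallness window read at a SMALLER radius `0 < γt ≤ u.γ` (`FlowStep.box_mono`).
* §3 (the ₁₃ `CoPH` record) `betaAlong_runFlow_ge_of_betaBoundsInInterval` (lower half along the runs of record from K1⁷'s window) · `alongLower_of_pinnedRuns` (for any `g`
  agreeing with `runFlow D g₀ K` up to the cutoff, `prefixOf (g K) m = prefixOf (runFlow D g₀ K) m` for `m ≤ K`, so the letter transports to the pinned runs).

HONEST FRAMING.  Count-neutral kernel bookkeeping; NE4 ∕ N17 ∕ N18 ∕ N22 ∕ (D4) are HYPOTHESES (`N17At`, `ReadOutAt`, `N18At`, `N22At` by name); the along-the-runs lower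
bound and K1⁷'s window are HYPOTHESES (lower half UNPRINTED, T09.F; upper half [Balaban1987RG1] (1.22) p. 264, proof deferred in print); nothing of Bałaban's is asserted or
instantiated (K0⁷ OPEN); NE7 NOT PRINTED ∕ NOT proved; N19 NOT discharged; K3⁷ NOT claimed; Track A count unmoved (typed 28∕28 · discharged 5∕27 · A 5∕28).  One finite
four-torus at fixed ε, rung (B)+1 — R4 closes the CONDITIONAL finite-𝕋⁴ rung `BalabanLadder.UV` only; NOT infinite volume, NOT OS on ℝ⁴, NOT a mass gap; the YM mass gap (Clay)
is NOT proved by any of this.  Standard axioms.  Supersedes nothing; edits nothing.  Shape reference: [Balaban1987RG1] (0.31) p. 259 (the NAME of the lower half — nothing asserted).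
-/

set_option autoImplicit false

noncomputable section

open Finset

namespace Summit.QuantumFields.YangMills.BalabanUVNodes.N19InEdgesAlongRuns

open Literature.MathematicalPhysics.QuantumFieldTheory.Balaban1983to89
open Literature.MathematicalPhysics.QuantumFieldTheory.Balaban1983to89.T4Continuum (T4Family FiniteEpsData)
open FlowStep (HBeta RGEqH prefixOf inv_sq_telescopeH)
open T4CouplingMatching (ScaleShiftRate HistLipschitz FadingMemory disc disc_nonneg disc_le_of_fadingMemory prof sprof prof_pos sprof_pos sprof_sq
  sum_profWeights_le)
open T4CauchySum (InjectedRate)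
open Summit.QuantumFields.BalabanUV.T4Continuum.Spine
open Summit.QuantumFields.BalabanUV.T4Continuum.Spine.NE4 (runFlow box_and_pin_of_tuned)
open Summit.QuantumFields.YangMills.BalabanUVNodes.N19InEdgesAtRecord (scaleShiftRate_of_n17At histCompanions_of_readOutAt)
open YMDAG.UVSplit (Datum U3Carriers N17At N18At N22At ReadOutAt)
open Node00 (Stage13HParams datumOfRecord₁₃CoPH)

/-! ## §1 Generic: node U2 with the lower β-bound read ALONG THE RUNS -/

section Generic

/-- WHERE ASYMPTOTIC FREEDOM ENTERS, ALONG ONE RUN: a lower bound `b ≤ β_m` AT THE RUN's OWN PREFIXES for `k₀ ≤ m < K` gives `1∕g_K² + b(K − i) ≤ 1∕g_i²` for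
`k₀ ≤ i ≤ K` (`FlowStep.inv_sq_telescopeH`; `T4CouplingMatching.inv_sq_lower_of_eventualLower` reads its box hypothesis exactly here and nowhere else). [folklore] -/
theorem inv_sq_lower_of_alongLower {β : HBeta} {b : ℝ} {k₀ K : ℕ} {g : ℕ → ℝ} (h : RGEqH K β g)
    (hlo : ∀ m, k₀ ≤ m → m < K → b ≤ β m (prefixOf g m)) {i : ℕ} (hk : k₀ ≤ i) (hi : i ≤ K) :
    1 / (g K) ^ 2 + b * ((K - i : ℕ) : ℝ) ≤ 1 / (g i) ^ 2 := by
  rw [inv_sq_telescopeH h hi le_rfl]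
  have hsum := Finset.card_nsmul_le_sum (Ico i K) (fun m => β m (prefixOf g m)) b
    (fun m hm => hlo m (hk.trans (Finset.mem_Ico.mp hm).1) (Finset.mem_Ico.mp hm).2)
  rw [Nat.card_Ico, nsmul_eq_mul] at hsum
  linarith

/-- **THE AF WEIGHT SUM IS K-UNIFORM — ALONG-THE-RUNS FORM** [folklore]: `T4CouplingMatching.sum_weights_le_of_eventualLower` with the eventual lower bound asked ONLY
along the two runs' own prefixes (`hloA` for run A's `m < K`, `hloB` for run B's `m < K + 1`); the proof is the tree's, `inv_sq_lower_of_alongLower` replacing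
`inv_sq_lower_of_eventualLower`. -/
theorem sum_weights_le_of_alongLower {β : HBeta} {γ b : ℝ} {k₀ K : ℕ} {gA gB : ℕ → ℝ}
    (hγ : 0 < γ) (hb : 0 < b) (hA : RGEqH K β gA) (hB : RGEqH (K + 1) β gB)
    (hAbox : ∀ i, i ≤ K → 0 < gA i ∧ gA i ≤ γ) (hBbox : ∀ i, i ≤ K + 1 → 0 < gB i ∧ gB i ≤ γ)
    (hloA : ∀ m, k₀ ≤ m → m < K → b ≤ β m (prefixOf gA m)) (hloB : ∀ m, k₀ ≤ m → m < K + 1 → b ≤ β m (prefixOf gB m)) :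
    ∑ i ∈ range (K + 1), (gA i) ^ 2 * gB (i + 1) ≤ ((k₀ : ℝ) + 1) * γ ^ 3 + 2 * γ / b := by
  have hp0 := sprof_pos hγ hb.le
  -- pointwise on the AF scales `k₀ ≤ i ≤ K`: u_i ≤ f (K - i) with f m = (1/p_m²)(1/p_m), p_m = √(1/γ² + b m)
  have hpt : ∀ i, k₀ ≤ i → i ≤ K →
      (gA i) ^ 2 * gB (i + 1) ≤ 1 / (sprof γ b (K - i)) ^ 2 * (1 / sprof γ b (K - i)) := by
    intro i hk hi
    have hgA := hAbox i hi
    have hgB := hBbox (i + 1) (by omega)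
    have hgAK := hAbox K le_rfl
    have hgBK := hBbox (K + 1) le_rfl
    have hAK : 1 / γ ^ 2 ≤ 1 / (gA K) ^ 2 :=
      one_div_le_one_div_of_le (pow_pos hgAK.1 2) (pow_le_pow_left₀ hgAK.1.le hgAK.2 2)
    have hBK : 1 / γ ^ 2 ≤ 1 / (gB (K + 1)) ^ 2 :=
      one_div_le_one_div_of_le (pow_pos hgBK.1 2) (pow_le_pow_left₀ hgBK.1.le hgBK.2 2)
    have h1 := inv_sq_lower_of_alongLower hA hloA hk hi
    have h2 := inv_sq_lower_of_alongLower hB hloB (i := i + 1) (by omega) (by omega)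
    have hKi : ((K + 1 - (i + 1) : ℕ) : ℝ) = ((K - i : ℕ) : ℝ) := by congr 1; omega
    rw [hKi] at h2
    have haA : prof γ b (K - i) ≤ 1 / (gA i) ^ 2 := by unfold prof; linarith
    have haB : prof γ b (K - i) ≤ 1 / (gB (i + 1)) ^ 2 := by unfold prof; linarith
    have hsqA : (gA i) ^ 2 ≤ 1 / (sprof γ b (K - i)) ^ 2 := by
      rw [sprof_sq hγ hb.le, le_one_div (pow_pos hgA.1 2) (prof_pos hγ hb.le _)]
      exact haA
    have hsqB : (gB (i + 1)) ^ 2 ≤ (1 / sprof γ b (K - i)) ^ 2 := by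
      rw [one_div_pow, sprof_sq hγ hb.le, le_one_div (pow_pos hgB.1 2) (prof_pos hγ hb.le _)]
      exact haB
    have hB' : gB (i + 1) ≤ 1 / sprof γ b (K - i) :=
      (pow_le_pow_iff_left₀ hgB.1.le (one_div_pos.mpr (hp0 _)).le two_ne_zero).mp hsqB
    exact mul_le_mul hsqA hB' hgB.1.le (by positivity)
  -- pointwise on all scales: u_i ≤ γ³ by the box alone
  have hcube : ∀ i, i ≤ K → (gA i) ^ 2 * gB (i + 1) ≤ γ ^ 3 := by
    intro i hi
    have hgA := hAbox i hi
    have hgB := hBbox (i + 1) (by omega)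
    calc (gA i) ^ 2 * gB (i + 1) ≤ γ ^ 2 * γ :=
          mul_le_mul (pow_le_pow_left₀ hgA.1.le hgA.2 2) hgB.2 hgB.1.le (sq_nonneg γ)
      _ = γ ^ 3 := by ring
  -- combine: u_i ≤ [i < k₀]·γ³ + f (K - i)
  have hmaj : ∀ i ∈ range (K + 1), (gA i) ^ 2 * gB (i + 1)
      ≤ (if i < k₀ then γ ^ 3 else 0) + 1 / (sprof γ b (K - i)) ^ 2 * (1 / sprof γ b (K - i)) := by
    intro i hi
    have hi' : i ≤ K := Nat.lt_succ_iff.mp (mem_range.mp hi)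
    have hf : 0 ≤ 1 / (sprof γ b (K - i)) ^ 2 * (1 / sprof γ b (K - i)) := by
      have := hp0 (K - i); positivity
    by_cases hik : i < k₀
    · rw [if_pos hik]; linarith [hcube i hi']
    · rw [if_neg hik, zero_add]; exact hpt i (not_lt.mp hik) hi'
  have hind : ∑ i ∈ range (K + 1), (if i < k₀ then γ ^ 3 else (0 : ℝ)) ≤ (k₀ : ℝ) * γ ^ 3 := by
    rw [Finset.sum_ite, Finset.sum_const_zero, add_zero, Finset.sum_const, nsmul_eq_mul]
    have hcard : ((range (K + 1)).filter (fun i => i < k₀)).card ≤ k₀ := by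
      calc ((range (K + 1)).filter (fun i => i < k₀)).card ≤ (range k₀).card :=
            Finset.card_le_card fun i hi => mem_range.mpr (Finset.mem_filter.mp hi).2
        _ = k₀ := Finset.card_range k₀
    exact mul_le_mul_of_nonneg_right (by exact_mod_cast hcard) (pow_nonneg hγ.le 3)
  calc ∑ i ∈ range (K + 1), (gA i) ^ 2 * gB (i + 1)
      ≤ ∑ i ∈ range (K + 1),
          ((if i < k₀ then γ ^ 3 else 0) + 1 / (sprof γ b (K - i)) ^ 2 * (1 / sprof γ b (K - i))) :=
        Finset.sum_le_sum hmaj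
    _ = (∑ i ∈ range (K + 1), (if i < k₀ then γ ^ 3 else (0 : ℝ)))
          + ∑ i ∈ range (K + 1), 1 / (sprof γ b (K - i)) ^ 2 * (1 / sprof γ b (K - i)) :=
        Finset.sum_add_distrib
    _ ≤ (k₀ : ℝ) * γ ^ 3 + (γ ^ 3 + 2 * γ / b) := add_le_add hind (sum_profWeights_le hγ hb K)
    _ = ((k₀ : ℝ) + 1) * γ ^ 3 + 2 * γ / b := by ring

/-- **NODE U2 IN THE SPINE's SHAPE — ALONG-THE-RUNS FORM** [folklore]: `T4CouplingMatching.injectedRate_of_runs_eventual` with `EventualLowerH b γ k₀ β` replaced by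
the lower bound along every run of the family, `∀ K m, k₀ ≤ m → m < K → b ≤ β m (prefixOf (g K) m)`; same conclusion
`InjectedRate (2c∕(1−θ)) 0 θ (fun K j ↦ disc (g K) (g (K+1)) j)`. -/
theorem injectedRate_of_runs_along {β : HBeta} {γ b c θ C : ℝ} {k₀ : ℕ} {Λ : ℕ → ℕ → ℝ} (g : ℕ → ℕ → ℝ)
    (gIR : ℝ) (hγ : 0 < γ) (hb : 0 < b) (hθ0 : 0 < θ) (hθ1 : θ < 1) (hc : 0 ≤ c) (hC : 0 ≤ C)
    (hrun : ∀ K, RGEqH K β (g K)) (hbox : ∀ K i, i ≤ K → 0 < g K i ∧ g K i ≤ γ)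
    (hpin : ∀ K, g K K = gIR)
    (hS : ScaleShiftRate c θ γ β) (hL : HistLipschitz Λ γ β) (hΛ : FadingMemory C θ Λ)
    (hlo : ∀ K m, k₀ ≤ m → m < K → b ≤ β m (prefixOf (g K) m)) (hsmall : C * (((k₀ : ℝ) + 1) * γ ^ 3 + 2 * γ / b) ≤ (1 - θ) / 2) :
    InjectedRate (2 * c / (1 - θ)) 0 θ (fun K j => disc (g K) (g (K + 1)) j) := by
  intro K j hj
  refine ⟨disc_nonneg _ _ _, ?_⟩
  have h := disc_le_of_fadingMemory hθ0 hθ1 hc hC (hrun K) (hrun (K + 1)) (hbox K) (hbox (K + 1))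
    ((hpin K).trans (hpin (K + 1)).symm) hS hL hΛ
    (sum_weights_le_of_alongLower hγ hb (hrun K) (hrun (K + 1)) (hbox K) (hbox (K + 1)) (hlo K) (hlo (K + 1))) hsmall j hj
  simpa using h

end Generic

/-! ## §2 Node U3's carriers: N17 · (D4) · N18 · N22 BY NAME ⟶ node U2's output, the β-window letter along the runs -/

section N17

variable {F : T4Family} {N : ℕ} [NeZero N]

/-- **N17 BY NAME ⟶ NODE U2's OUTPUT, ALONG-THE-RUNS β-WINDOW** [folklore]: dag-n19-a's `injectedRate_of_n17At` with `EventualLowerH b u.γ k₀ D.βfun` replaced by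
`∀ K m, k₀ ≤ m → m < K → b ≤ D.βfun m (prefixOf (g K) m)`. -/
theorem injectedRate_of_n17At_along (D : Datum F N) {u : U3Carriers} (h17 : N17At D u) {g : ℕ → ℕ → ℝ} {gIR b Cβ : ℝ} {k₀ : ℕ}
    {Λβ : ℕ → ℕ → ℝ} (hγ : 0 < u.γ) (hb : 0 < b) (hρ0 : 0 < u.ρ) (hρ1 : u.ρ < 1) (hc : 0 ≤ u.cr * u.C₅ * u.θ) (hCβ : 0 ≤ Cβ)
    (hrun : ∀ K, RGEqH K D.βfun (g K)) (hbox : ∀ K i, i ≤ K → 0 < g K i ∧ g K i ≤ u.γ) (hpin : ∀ K, g K K = gIR)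
    (hL : HistLipschitz Λβ u.γ D.βfun) (hΛ : T4CouplingMatching.FadingMemory Cβ u.ρ Λβ)
    (hlo : ∀ K m, k₀ ≤ m → m < K → b ≤ D.βfun m (prefixOf (g K) m))
    (hsmall : Cβ * (((k₀ : ℝ) + 1) * u.γ ^ 3 + 2 * u.γ / b) ≤ (1 - u.ρ) / 2) :
    InjectedRate (2 * (u.cr * u.C₅ * u.θ) / (1 - u.ρ)) 0 u.ρ fun K j => disc (g K) (g (K + 1)) j :=
  injectedRate_of_runs_along g gIR hγ hb hρ0 hρ1 hc hCβ hrun hbox hpin (scaleShiftRate_of_n17At D h17) hL hΛ hlo hsmall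

/-- **N17 · (D4) · N18 · N22 BY NAME ⟶ NODE U2's OUTPUT, ALONG-THE-RUNS β-WINDOW** [folklore]: dag-n19-a's `injectedRate_of_n17At_readOutAt` with the same replacement
(the history companions from `histCompanions_of_readOutAt` unchanged). -/
theorem injectedRate_of_n17At_readOutAt_along (D : Datum F N) {u : U3Carriers} (h17 : N17At D u) (hD4 : ReadOutAt D u) (h18 : N18At u)
    (h22 : N22At u) {g : ℕ → ℕ → ℝ} {gIR b : ℝ} {k₀ : ℕ} (hγ : 0 < u.γ) (hb : 0 < b) (hρ0 : 0 < u.ρ) (hρ1 : u.ρ < 1)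
    (hrun : ∀ K, RGEqH K D.βfun (g K)) (hbox : ∀ K i, i ≤ K → 0 < g K i ∧ g K i ≤ u.γ) (hpin : ∀ K, g K K = gIR)
    (hlo : ∀ K m, k₀ ≤ m → m < K → b ≤ D.βfun m (prefixOf (g K) m))
    (hsmall : u.cr * u.C₉ * u.ω * (((k₀ : ℝ) + 1) * u.γ ^ 3 + 2 * u.γ / b) ≤ (1 - u.ρ) / 2) :
    InjectedRate (2 * (u.cr * u.C₅ * u.θ) / (1 - u.ρ)) 0 u.ρ fun K j => disc (g K) (g (K + 1)) j := by
  obtain ⟨hL, hΛ, hc, hC⟩ := histCompanions_of_readOutAt D hD4 h18 h22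
  exact injectedRate_of_n17At_along D h17 hγ hb hρ0 hρ1 hc hC hrun hbox hpin hL hΛ hlo hsmall

/-- **… AT THE RUNS' OWN RADIUS** [folklore]: if the family of runs lives in a SMALLER box `]0, γt]`, `0 < γt ≤ u.γ` (the runs of a bare sequence tuned within `]0, γt]`),
node U2's inputs restrict to it (`FlowStep.box_mono`: NE4's `ScaleShiftRate` and the history-Lipschitz companion are box statements) and the AF weight sum is read at `γt`:
the smallness window becomes `u.cr·u.C₉·u.ω·((k₀+1)γt³ + 2γt∕b) ≤ (1−u.ρ)∕2` — WEAKER than at the carriers' radius `u.γ`, and small for small `γt`. -/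
theorem injectedRate_of_n17At_readOutAt_along_radius (D : Datum F N) {u : U3Carriers} (h17 : N17At D u) (hD4 : ReadOutAt D u) (h18 : N18At u)
    (h22 : N22At u) {g : ℕ → ℕ → ℝ} {gIR b γt : ℝ} {k₀ : ℕ} (hγt0 : 0 < γt) (hγt : γt ≤ u.γ) (hb : 0 < b) (hρ0 : 0 < u.ρ) (hρ1 : u.ρ < 1)
    (hrun : ∀ K, RGEqH K D.βfun (g K)) (hbox : ∀ K i, i ≤ K → 0 < g K i ∧ g K i ≤ γt) (hpin : ∀ K, g K K = gIR)
    (hlo : ∀ K m, k₀ ≤ m → m < K → b ≤ D.βfun m (prefixOf (g K) m))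
    (hsmall : u.cr * u.C₉ * u.ω * (((k₀ : ℝ) + 1) * γt ^ 3 + 2 * γt / b) ≤ (1 - u.ρ) / 2) :
    InjectedRate (2 * (u.cr * u.C₅ * u.θ) / (1 - u.ρ)) 0 u.ρ fun K j => disc (g K) (g (K + 1)) j := by
  obtain ⟨hL, hΛ, hc, hC⟩ := histCompanions_of_readOutAt D hD4 h18 h22
  have hS : ScaleShiftRate (u.cr * u.C₅ * u.θ) u.ρ γt D.βfun := fun k w hw =>
    scaleShiftRate_of_n17At D h17 k w (FlowStep.box_mono hγt (k + 1) hw)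
  have hL' : HistLipschitz (fun k i => u.cr * u.Λ (k + 1) i) γt D.βfun := fun k p q hp hq =>
    hL k p q (FlowStep.box_mono hγt k hp) (FlowStep.box_mono hγt k hq)
  exact injectedRate_of_runs_along g gIR hγt0 hb hρ0 hρ1 hc hC hrun hbox hpin hS hL' hΛ hlo hsmall

end N17

/-! ## §3 At the ₁₃ `CoPH` record: the along-the-runs lower bound IS the lower half of K1⁷'s interval-form window -/

section AtRecord

variable {F : T4Family} {N : ℕ} [NeZero N]

/-- **β ALONG THE HISTORIES OF RECORD IS BOUNDED BELOW BY K1⁷'s INTERVAL-FORM WINDOW** [bookkeeping]: `BetaBoundsInInterval D.C.toB12 γ₀ b b′` (the β-window binder of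
the K1⁷ skeleton's rung 2 ∕ N24's knit; lower half UNPRINTED, T09.F) gives, along every cutoff-`K` run in `]0, γ]`, `γ ≤ γ₀`, the bound `b ≤ D.βfun i (g_0,…,g_i)` for
`i < K` — the twin of this seat's g0 `betaAlong_runFlow_le_of_betaBoundsInInterval` (`D.curries` + `DagBinding.update_prefixOf_last`), reading the window's FIRST conjunct. -/
theorem betaAlong_runFlow_ge_of_betaBoundsInInterval (D : Datum F N) {γ₀ b b' γ : ℝ} (hβ : DagBinding.BetaBoundsInInterval D.C.toB12 γ₀ b b') (hγle : γ ≤ γ₀)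
    {g₀ : ℕ → ℝ} {K : ℕ} (hI : (D.C ⟨K, F.m, g₀ K⟩).flow.InInterval γ K) :
    ∀ i, i < K → b ≤ D.βfun i (prefixOf (runFlow D g₀ K) i) := by
  intro i hi
  have hc := D.curries ⟨K, F.m, g₀ K⟩ i ((D.C.toB12 ⟨K, F.m, g₀ K⟩).flow.g i) hi
  rw [DagBinding.update_prefixOf_last] at hc
  have h := (hβ ⟨K, F.m, g₀ K⟩ i ((D.C.toB12 ⟨K, F.m, g₀ K⟩).flow.g i) hi
    (fun l hl => ⟨(hI l (by omega)).1, (hI l (by omega)).2.trans hγle⟩) (hI i hi.le).1 ((hI i hi.le).2.trans hγle)).1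
  rw [hc] at h
  exact h

/-- … hence along EVERY run of record of a TUNED bare sequence (`D.Tuned γ gIR g₀`, `γ ≤ γ₀`), from scale `0` on (`k₀ := 0` in the along-the-runs letter). [bookkeeping] -/
theorem alongLower_runFlow_of_tuned (D : Datum F N) {γ₀ b b' γ gIR : ℝ} {g₀ : ℕ → ℝ} (hβ : DagBinding.BetaBoundsInInterval D.C.toB12 γ₀ b b')
    (hγle : γ ≤ γ₀) (ht : D.Tuned γ gIR g₀) :
    ∀ K m, 0 ≤ m → m < K → b ≤ D.βfun m (prefixOf (runFlow D g₀ K) m) :=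
  fun K m _ hm => betaAlong_runFlow_ge_of_betaBoundsInInterval D hβ hγle (ht K).1 m hm

/-- **TRANSPORT TO THE PINNED RUNS** [folklore]: for ANY `g` agreeing with `runFlow D g₀ K` up to the cutoff (the first pin clause of this seat's link reading at the runs
of record), `prefixOf (g K) m = prefixOf (runFlow D g₀ K) m` for `m ≤ K`, so an along-the-runs lower bound for the runs of record is one for `g`. -/
theorem alongLower_of_pinnedRuns (D : Datum F N) {b : ℝ} {k₀ : ℕ} {g₀ : ℕ → ℝ} {g : ℕ → ℕ → ℝ}
    (hle : ∀ K i, i ≤ K → g K i = runFlow D g₀ K i) (hlo : ∀ K m, k₀ ≤ m → m < K → b ≤ D.βfun m (prefixOf (runFlow D g₀ K) m)) :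
    ∀ K m, k₀ ≤ m → m < K → b ≤ D.βfun m (prefixOf (g K) m) := by
  intro K m hk hm
  have hpre : prefixOf (g K) m = prefixOf (runFlow D g₀ K) m := by
    funext i
    simp only [FlowStep.prefixOf_apply]
    exact hle K i ((Nat.lt_succ_iff.mp i.isLt).trans hm.le)
  rw [hpre]
  exact hlo K m hk hm

end AtRecord

end Summit.QuantumFields.YangMills.BalabanUVNodes.N19InEdgesAlongRuns

end
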